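import Summits.PneNP.PneNP.Theorems.ConvexRankGatesConvexGateBlindExactLiftingTriangleLineRepUnique

/-!
# Triangle instance — regroupings: a generator in `cone{1_L}` is used on a nondegenerate row only where all its lines are monochromatic

Support file for crux `ConvexGateBlind` (stmt-PneNP-10680), open stub `stub_exactLifting`; prover seat 0, session 35,
memo ANALYSIS14 §5.1. Toward R1′ (generator rigidity of the cheap corner of `M_t`) in the REGROUPING CLASS: non-negative
factorisations `M_t = Σ_i u_i ⊗ g_i` whose column functions are non-negative combinations of line indicators,
`g_i = Σ_L α_{iL} 1_L` with `α ≥ 0` (lines, stars, planes, … — every sub-`t³` factorisation found numerically at `t = 4` is of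
this kind, ANALYSIS13 §5). By uniqueness of the line representation of a nondegenerate row (`lineRep_unique`):
* the aggregated usage of every line is forced: `Σ_i u_i(x) α_{iL} = [L mono_x]` (`regrouping_coeff`);
* hence a generator with `u_i(x) > 0` has `α_{iL} = 0` on every line bichromatic under `x` (`regrouping_usage`): on a
  nondegenerate row a regrouping generator is usable only if ALL the lines it is built from are monochromatic — the covering
  condition (COV) of the memo, whose LP dual is the route to "regrouping rigidity" (`R ≥ 3t²`, equality only for the lines).
Registered sub-goal `triangle_regrouping_usage` (self-contained signature).
-/

set_option linter.dupNamespace false -- `Summit.PneNP.PneNP.…`: summit = sub-problem (D-0017)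

namespace Summit.PneNP.PneNP.Theorems.XorDoor.TriLine

open Finset

noncomputable section

variable {t : ℕ} {ι : Type} [Fintype ι]

/-- **Aggregated line usage of a regrouping is forced on nondegenerate rows.** If `Σ_i u_i(x) g_i = M_x` with `u ≥ 0` and
`g_i = Σ_L α_{iL} 1_L`, `α ≥ 0`, and `mu x ≠ 0`, then `Σ_i u_i(x) α_{iL} = [L mono_x]` for every line `L`. -/
theorem regrouping_coeff {x : Col t} (hx : mu x ≠ 0) {u : ι → ℝ} (hu : ∀ i, 0 ≤ u i) {α : ι → Line t → ℝ}
    (hα : ∀ i L, 0 ≤ α i L) (hfact : ∀ w, ∑ i, u i * ∑ L, α i L * lind L w = (monoCount x w : ℝ)) (L : Line t) :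
    ∑ i, u i * α i L = mInd x L := by
  refine lineRep_unique hx (c := fun L => ∑ i, u i * α i L)
    (fun L _ => sum_nonneg fun i _ => mul_nonneg (hu i) (hα i L)) (fun w => ?_) L
  rw [← hfact w]
  simp only [sum_mul, mul_sum]
  rw [sum_comm]
  exact sum_congr rfl fun i _ => sum_congr rfl fun L _ => by ring

/-- **(COV)** A regrouping generator used on a nondegenerate row is built from monochromatic lines only: if moreover
`u_i(x) > 0` and `α_{iL} > 0` then `L` is monochromatic under `x`. -/
theorem regrouping_usage {x : Col t} (hx : mu x ≠ 0) {u : ι → ℝ} (hu : ∀ i, 0 ≤ u i) {α : ι → Line t → ℝ}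
    (hα : ∀ i L, 0 ≤ α i L) (hfact : ∀ w, ∑ i, u i * ∑ L, α i L * lind L w = (monoCount x w : ℝ))
    {i : ι} {L : Line t} (hi : 0 < u i) (hiL : 0 < α i L) : lmono x L := by
  by_contra hm
  have h := regrouping_coeff hx hu hα hfact L
  unfold mInd at h
  rw [if_neg hm] at h
  have hle : u i * α i L ≤ ∑ j, u j * α j L :=
    single_le_sum (f := fun j => u j * α j L) (fun j _ => mul_nonneg (hu j) (hα j L)) (mem_univ i)
  rw [h] at hle
  exact absurd hle (not_le.2 (mul_pos hi hiL))

/-- **Regrouping generators serve nondegenerate rows through monochromatic lines only** (registered sub-goal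
`triangle_regrouping_usage` of stmt-PneNP-10680, verbatim signature, self-contained vocabulary): rows `x` = three
`2`-colourings with every block two-coloured, `R` generators `g_i = Σ_L α_{iL} 1_L` (`α ≥ 0`, lines indexed by
`(Fin t × Fin t) ⊕ (Fin t × Fin t) ⊕ (Fin t × Fin t)`), usage `u ≥ 0` with `Σ_i u_i g_i(w)` = number of monochromatic edges
of `w`; then `u_i > 0 ∧ α_{iL} > 0` forces the two fixed vertices of `L` to have the same colour. -/
theorem triangle_regrouping_usage : ∀ (t R : ℕ) (x : (Fin t → Bool) × (Fin t → Bool) × (Fin t → Bool)) (u : Fin R → ℝ)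
    (α : Fin R → (Fin t × Fin t) ⊕ (Fin t × Fin t) ⊕ (Fin t × Fin t) → ℝ), (∃ a a', x.1 a ≠ x.1 a') → (∃ b b', x.2.1 b
    ≠ x.2.1 b') → (∃ d d', x.2.2 d ≠ x.2.2 d') → (∀ i, 0 ≤ u i) → (∀ i L, 0 ≤ α i L) → (∀ w : Fin t × Fin t × Fin t,
    ∑ i, u i * ∑ L, α i L * Sum.elim (fun ab : Fin t × Fin t => if w.1 = ab.1 ∧ w.2.1 = ab.2 then (1 : ℝ) else 0)
    (Sum.elim (fun ad : Fin t × Fin t => if w.1 = ad.1 ∧ w.2.2 = ad.2 then (1 : ℝ) else 0) (fun bd : Fin t × Fin t =>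
    if w.2.1 = bd.1 ∧ w.2.2 = bd.2 then (1 : ℝ) else 0)) L = ((if x.1 w.1 = x.2.1 w.2.1 then 1 else 0) + (if x.1 w.1
    = x.2.2 w.2.2 then 1 else 0) + (if x.2.1 w.2.1 = x.2.2 w.2.2 then 1 else 0) : ℝ)) → ∀ (i : Fin R) (L : (Fin t × Fin
    t) ⊕ (Fin t × Fin t) ⊕ (Fin t × Fin t)), 0 < u i → 0 < α i L → Sum.elim (fun ab : Fin t × Fin t => x.1 ab.1 =
    x.2.1 ab.2) (Sum.elim (fun ad : Fin t × Fin t => x.1 ad.1 = x.2.2 ad.2) (fun bd : Fin t × Fin t => x.2.1 bd.1 =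
    x.2.2 bd.2)) L := by
  intro t R x u α h1 h2 h3 hu hα hfact i L hi hiL
  have hx : mu x ≠ 0 := (mu_ne_zero_iff_two_coloured x).2 ⟨h1, h2, h3⟩
  have hf : ∀ w, ∑ i, u i * ∑ L, α i L * lind L w = (monoCount x w : ℝ) := by
    intro w
    rw [← sum_congr rfl fun i _ => by rw [← sum_congr rfl fun L _ => by rw [lind_eq_elim L w]], hfact w]
    simp only [monoCount]; push_cast; ring
  exact regrouping_usage hx hu hα hf hi hiL

end

end Summit.PneNP.PneNP.Theorems.XorDoor.TriLine
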